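import Literature.NumberTheory.Automorphic.FundamentalDomainUnfolding
import HarnessLib

/-!
# A fundamental domain for `Γ₀(q)` and covering multiplicities (DFI 1995, Prop. 4, support file)

Topic `Literature/NumberTheory/Sieve`.  First support file of an elementary proof of
Proposition 4 of W. Duke, J. B. Friedlander, H. Iwaniec, *Equidistribution of roots of a quadratic
congruence to prime moduli*, Ann. of Math. 141 (1995): the estimate for the values `P(τz)` of the
Poincaré series (14) (p. 428) which the paper derives from the spectral theory of `Γ₀(q)∖ℍ`
(Proposition 3, p. 431).  Our route replaces the pre-trace formula by a local Sobolev inequality,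
a covering-multiplicity bound and unfolding; this file provides the group-theoretic and
measure-theoretic base, on top of the `Literature.NumberTheory.Automorphic` framework
(`IsHypFundamentalDomain`, `tsum_setLIntegral_smul_eq` of `FundamentalDomainUnfolding.lean`,
Mathlib's `UpperHalfPlane.Measure`, `ModularGroup.fd`, `CongruenceSubgroup.Gamma0`):

* `Gamma0GL q ≤ GL₂(ℝ)` — the image of Mathlib's `Γ₀(q) ≤ SL₂(ℤ)`; it is countable, contains `-1`
  and lies in the image `𝒮ℒ` of `SL₂(ℤ)`;
* `exists_rightTransversal` — a finite set `T ⊆ SL₂(ℤ)` with `SL₂(ℤ) = ⊔_{t ∈ T} Γ₀(q) t`;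
* `gamma0Domain T = ⋃_{t ∈ T} t 𝒟` and **`isHypFundamentalDomain_gamma0Domain`**: it is a
  fundamental domain for `Γ₀(q)` (orbits meet it; a.e. uniqueness from Mathlib's
  `ModularGroup.eq_one_or_neg_one_of_mem_fdo_mem_fd` and the null boundary of `𝒟`,
  `volume_modular_fd_diff_fdo`);
* `exists_multiplicity_bound` — for compact `K ⊆ ℍ` there is `M` with
  `#{γ ∈ SL₂(ℤ) : γ w ∈ K} ≤ M` for all `w` (proper discontinuity, Mathlib's
  `properlyDiscontinuousSL2ZRange`), and **`setLIntegral_le_of_invariant`**: for a `Γ`-invariant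
  `G ≥ 0` and such a `K`, `∫_K G dμ ≤ (M/2) ∫_F G dμ` for any fundamental domain `F` of a subgroup
  `Γ ≤ 𝒮ℒ` containing `-1` (unfolding).

All of this is standard (Iwaniec, *Spectral methods of automorphic forms*, §§2.1–2.4, 3.2); no
statement of the paper is formalised here.

## References

* W. Duke, J. B. Friedlander, H. Iwaniec, Ann. of Math. (2) 141 (1995), 423–441, §§2–3.
  [cite: DukeFriedlanderIwaniec1995, §3]
* H. Iwaniec, *Spectral Methods of Automorphic Forms*, 2nd ed., GSM 53 (2002), §2.2–2.4.
  [cite: Iwaniec2002, §2.2–2.4]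
-/

noncomputable section

namespace Literature.NumberTheory.Sieve

open _root_.MeasureTheory _root_.UpperHalfPlane _root_.ModularGroup
open _root_.Literature.NumberTheory.Automorphic
open scoped Modular MatrixGroups ENNReal Topology

namespace DFI1995

/-! ### `Γ₀(q)` inside `GL₂(ℝ)` -/

/-- The Hecke congruence group `Γ₀(q)` as a subgroup of `GL₂(ℝ)` (image of Mathlib's
`CongruenceSubgroup.Gamma0 q ≤ SL(2, ℤ)` under `mapGL ℝ`). [cite: DukeFriedlanderIwaniec1995, §2 p. 427] -/
def Gamma0GL (q : ℕ) : Subgroup (GL (Fin 2) ℝ) :=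
  (CongruenceSubgroup.Gamma0 q).map (Matrix.SpecialLinearGroup.mapGL ℝ)

variable {q : ℕ}

/-- Membership in `Gamma0GL q`. [folklore] -/
theorem mem_Gamma0GL_iff {γ : GL (Fin 2) ℝ} :
    γ ∈ Gamma0GL q ↔ ∃ g : SL(2, ℤ), g ∈ CongruenceSubgroup.Gamma0 q ∧
      Matrix.SpecialLinearGroup.mapGL ℝ g = γ := by
  simp [Gamma0GL, Subgroup.mem_map]

/-- `SL₂(ℤ) → GL₂(ℝ)` is injective. [folklore] -/
theorem mapGL_injective :
    Function.Injective (Matrix.SpecialLinearGroup.mapGL ℝ : SL(2, ℤ) → GL (Fin 2) ℝ) := by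
  intro g g' h
  ext i j
  have := congrArg (fun m : GL (Fin 2) ℝ => (m : Matrix (Fin 2) (Fin 2) ℝ) i j) h
  simpa [Matrix.SpecialLinearGroup.mapGL, Matrix.SpecialLinearGroup.toGL] using this

/-- `mapGL ℝ g ∈ Gamma0GL q ↔ g ∈ Γ₀(q)` (injectivity of `SL₂(ℤ) → GL₂(ℝ)`). [folklore] -/
theorem mapGL_mem_Gamma0GL_iff {g : SL(2, ℤ)} :
    Matrix.SpecialLinearGroup.mapGL ℝ g ∈ Gamma0GL q ↔ g ∈ CongruenceSubgroup.Gamma0 q := by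
  rw [mem_Gamma0GL_iff]
  constructor
  · rintro ⟨g', hg', he⟩
    rwa [← mapGL_injective he]
  · intro hg; exact ⟨g, hg, rfl⟩

/-- `Gamma0GL q ≤ 𝒮ℒ`. [folklore] -/
theorem Gamma0GL_le_modular : Gamma0GL q ≤ (𝒮ℒ : Subgroup (GL (Fin 2) ℝ)) := by
  rintro γ hγ
  obtain ⟨g, -, rfl⟩ := mem_Gamma0GL_iff.1 hγ
  exact ⟨g, rfl⟩

/-- `Gamma0GL q` consists of (images of) matrices of determinant one. [folklore] -/
theorem Gamma0GL_le_range_toGL :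
    Gamma0GL q ≤ (Matrix.SpecialLinearGroup.toGL : SL(2, ℝ) →* GL (Fin 2) ℝ).range :=
  Gamma0GL_le_modular.trans modular_le_range_toGL

/-- `-1 ∈ Γ₀(q)`. [folklore] -/
theorem neg_one_mem_Gamma0 : (-1 : SL(2, ℤ)) ∈ CongruenceSubgroup.Gamma0 q := by
  rw [CongruenceSubgroup.Gamma0_mem]
  simp

/-- `-1 ∈ Gamma0GL q`. [folklore] -/
theorem neg_one_mem_Gamma0GL : (-1 : GL (Fin 2) ℝ) ∈ Gamma0GL q := by
  have h : Matrix.SpecialLinearGroup.mapGL ℝ (-1 : SL(2, ℤ)) = (-1 : GL (Fin 2) ℝ) := by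
    ext i j
    fin_cases i <;> fin_cases j <;>
      simp [Matrix.SpecialLinearGroup.mapGL, Matrix.SpecialLinearGroup.toGL]
  rw [← h]
  exact mapGL_mem_Gamma0GL_iff.2 neg_one_mem_Gamma0

/-- `Gamma0GL q` is countable. [folklore] -/
theorem countable_Gamma0GL : (Gamma0GL q : Set (GL (Fin 2) ℝ)).Countable :=
  (isDiscreteSubgroup_modular.countable).mono Gamma0GL_le_modular

/-! ### A right transversal of `Γ₀(q)` in `SL₂(ℤ)` -/

/-- `T ⊆ SL₂(ℤ)` is a right transversal of `Γ₀(q)`: every `g` is `γ t` with `γ ∈ Γ₀(q)` for a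
unique `t ∈ T`. [folklore] -/
def IsRightTransversal (q : ℕ) (T : Finset SL(2, ℤ)) : Prop :=
  ∀ g : SL(2, ℤ), ∃! t : SL(2, ℤ), t ∈ T ∧ g * t⁻¹ ∈ CongruenceSubgroup.Gamma0 q

/-- A finite right transversal of `Γ₀(q)` in `SL₂(ℤ)` exists (`Γ₀(q)` has finite index, Mathlib
`CongruenceSubgroup.instFiniteIndexGamma0`, and `Subgroup.exists_isComplement_right`).
[folklore] -/
theorem exists_rightTransversal (q : ℕ) [NeZero q] : ∃ T : Finset SL(2, ℤ), IsRightTransversal q T := by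
  obtain ⟨S, hS, -⟩ := Subgroup.exists_isComplement_right (CongruenceSubgroup.Gamma0 q) (1 : SL(2, ℤ))
  have hfin : S.Finite := hS.finite_right
  refine ⟨hfin.toFinset, fun g => ?_⟩
  obtain ⟨⟨h, t⟩, he, huniq⟩ := hS.existsUnique g
  refine ⟨t, ⟨by simp, ?_⟩, ?_⟩
  · have : g * (t : SL(2, ℤ))⁻¹ = h := by rw [← he]; group
    rw [this]; exact h.2
  · rintro t' ⟨ht', hgt'⟩
    have ht'S : t' ∈ S := by simpa using ht'
    have := huniq ⟨⟨g * t'⁻¹, hgt'⟩, ⟨t', ht'S⟩⟩ (by simp)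
    exact congrArg (fun x : ↥(CongruenceSubgroup.Gamma0 q) × ↥S => (x.2 : SL(2, ℤ))) this.symm
      |>.symm ▸ rfl

/-! ### The fundamental domain `⋃_{t ∈ T} t 𝒟` of `Γ₀(q)` -/

/-- The union of the translates `t 𝒟`, `t ∈ T`, of the standard fundamental domain.
[cite: Iwaniec2002, §2.4 (Prop. 2.4: `F_Γ' = ⋃ γᵢ F_Γ` for a finite-index subgroup), PDF p. 31] -/
def gamma0Domain (T : Finset SL(2, ℤ)) : Set ℍ := {z : ℍ | ∃ t ∈ T, t⁻¹ • z ∈ 𝒟}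

variable {T : Finset SL(2, ℤ)}

/-- `gamma0Domain T` is measurable. [folklore] -/
theorem measurableSet_gamma0Domain : MeasurableSet (gamma0Domain T) := by
  have : gamma0Domain T = ⋃ t ∈ T, (fun z : ℍ => t⁻¹ • z) ⁻¹' 𝒟 := by
    ext z; simp [gamma0Domain]
  rw [this]
  refine Finset.measurableSet_biUnion _ fun t _ => ?_
  exact isClosed_fd.measurableSet.preimage (by
    change Measurable fun z : ℍ => ((t⁻¹ : SL(2, ℤ)) : GL (Fin 2) ℝ) • z
    exact measurable_const_smul _)

/-- The points of `ℍ` whose `SL₂(ℤ)`-orbit meets the boundary of `𝒟`: a null set.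
[folklore] -/
def fdBoundaryOrbit : Set ℍ := ⋃ g : SL(2, ℤ), (fun z : ℍ => g • z) ⁻¹' (𝒟 \ 𝒟ᵒ)

/-- The exceptional set is null (countably many null preimages). [folklore] -/
theorem volume_fdBoundaryOrbit : volume fdBoundaryOrbit = 0 := by
  have : Countable SL(2, ℤ) := by
    have : Countable (Matrix (Fin 2) (Fin 2) ℤ) := by unfold Matrix; infer_instance
    exact Subtype.countable
  rw [fdBoundaryOrbit, measure_iUnion_null_iff]
  intro g
  change volume ((fun z : ℍ => (g : GL (Fin 2) ℝ) • z) ⁻¹' (𝒟 \ 𝒟ᵒ)) = 0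
  rw [measure_preimage_smul]
  exact volume_modular_fd_diff_fdo

/-- Off the exceptional set, a translate lying in `𝒟` lies in `𝒟ᵒ`. [folklore] -/
theorem smul_mem_fdo_of_not_mem_fdBoundaryOrbit {z : ℍ} (hz : z ∉ fdBoundaryOrbit)
    {g : SL(2, ℤ)} (hg : g • z ∈ 𝒟) : g • z ∈ 𝒟ᵒ := by
  by_contra h
  exact hz (Set.mem_iUnion.2 ⟨g, ⟨hg, h⟩⟩)

/-- **`⋃_{t ∈ T} t 𝒟` is a fundamental domain for `Γ₀(q)`** when `T` is a right transversal of
`Γ₀(q)` in `SL₂(ℤ)`. [cite: Iwaniec2002, §2.4 (fundamental domain of a finite-index subgroup), PDF p. 31] -/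
theorem isHypFundamentalDomain_gamma0Domain (hT : IsRightTransversal q T) :
    IsHypFundamentalDomain (Gamma0GL q) (gamma0Domain T) := by
  refine ⟨measurableSet_gamma0Domain, fun z => ?_, ?_⟩
  · -- covering
    obtain ⟨g₀, hg₀⟩ := exists_smul_mem_fd z
    obtain ⟨t, ⟨htT, hγ⟩, -⟩ := hT g₀⁻¹
    refine ⟨Matrix.SpecialLinearGroup.mapGL ℝ (t * g₀), ?_, ?_⟩
    · rw [mapGL_mem_Gamma0GL_iff]
      have : t * g₀ = (g₀⁻¹ * t⁻¹)⁻¹ := by group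
      rw [this]
      exact Subgroup.inv_mem _ hγ
    · refine ⟨t, htT, ?_⟩
      change t⁻¹ • ((t * g₀) • z) ∈ 𝒟
      rwa [← mul_smul, inv_mul_cancel_left]
  · -- a.e. uniqueness
    have hae : ∀ᵐ z : ℍ, z ∉ fdBoundaryOrbit := by
      rw [ae_iff]; simpa using volume_fdBoundaryOrbit
    filter_upwards [hae] with z hz hzF γ hγ hγz
    obtain ⟨g, hg, rfl⟩ := mem_Gamma0GL_iff.1 hγ
    change g • z ∈ gamma0Domain T at hγz
    change g • z = z
    obtain ⟨t₁, ht₁, h1⟩ := hzF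
    obtain ⟨t₂, ht₂, h2⟩ := hγz
    have h1o : t₁⁻¹ • z ∈ 𝒟ᵒ := smul_mem_fdo_of_not_mem_fdBoundaryOrbit hz h1
    have h2' : (t₂⁻¹ * g * t₁) • (t₁⁻¹ • z) ∈ 𝒟 := by
      rwa [← mul_smul, show t₂⁻¹ * g * t₁ * t₁⁻¹ = t₂⁻¹ * g by group, mul_smul]
    have hpm : t₂⁻¹ * g * t₁ = 1 ∨ t₂⁻¹ * g * t₁ = -1 := eq_one_or_neg_one_of_mem_fdo_mem_fd h1o h2'
    -- in either case `g t₁ = ± t₂`, so uniqueness of the transversal forces `t₁ = t₂`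
    have hgt : g * t₁ = t₂ ∨ g * t₁ = -t₂ := by
      rcases hpm with h | h
      · left
        calc g * t₁ = t₂ * (t₂⁻¹ * g * t₁) := by group
          _ = t₂ := by rw [h, mul_one]
      · right
        calc g * t₁ = t₂ * (t₂⁻¹ * g * t₁) := by group
          _ = -t₂ := by rw [h]; simp
    have ht12 : t₁ = t₂ := by
      obtain ⟨t, -, huniq⟩ := hT (g * t₁)
      have e1 : t₁ = t := huniq t₁ ⟨ht₁, by simp [hg]⟩
      have e2 : t₂ = t := huniq t₂ ⟨ht₂, by
        rcases hgt with h | h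
        · rw [h]; simp
        · rw [h]; simp⟩
      rw [e1, e2]
    subst ht12
    rcases hgt with h | h
    · have : g = 1 := by simpa using h
      simp [this]
    · have : g = -1 := by
        have := congrArg (· * t₁⁻¹) h
        simpa using this
      rw [this, SL_neg_smul, one_smul]

/-! ### Covering multiplicities -/

/-- Orbit counting: the number of `γ ∈ 𝒮ℒ` with `γ w ∈ K` is at most the number of `γ` with
`γ K ∩ K ≠ ∅`. [folklore] -/
theorem tsum_indicator_smul_le_card {K : Set ℍ} {F : Finset (𝒮ℒ : Subgroup (GL (Fin 2) ℝ))}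
    (hF : ∀ γ : (𝒮ℒ : Subgroup (GL (Fin 2) ℝ)), ((γ • ·) '' K ∩ K).Nonempty → γ ∈ F) (w : ℍ) :
    ∑' γ : (𝒮ℒ : Subgroup (GL (Fin 2) ℝ)), K.indicator (1 : ℍ → ℝ≥0∞) (γ • w) ≤ F.card := by
  classical
  by_cases hex : ∃ g₁ : (𝒮ℒ : Subgroup (GL (Fin 2) ℝ)), g₁ • w ∈ K
  · obtain ⟨g₁, hg₁⟩ := hex
    set S : Finset (𝒮ℒ : Subgroup (GL (Fin 2) ℝ)) := F.image (· * g₁) with hS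
    have hsupp : ∀ g : (𝒮ℒ : Subgroup (GL (Fin 2) ℝ)), g ∉ S →
        K.indicator (1 : ℍ → ℝ≥0∞) (g • w) = 0 := by
      intro g hg
      apply Set.indicator_of_notMem
      intro hgw
      apply hg
      rw [hS, Finset.mem_image]
      refine ⟨g * g₁⁻¹, hF _ ⟨g • w, ⟨g₁ • w, hg₁, ?_⟩, hgw⟩, by simp⟩
      simp [← mul_smul]
    rw [tsum_eq_sum (s := S) (fun g hg => hsupp g hg)]
    calc ∑ g ∈ S, K.indicator (1 : ℍ → ℝ≥0∞) (g • w) ≤ ∑ g ∈ S, (1 : ℝ≥0∞) :=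
          Finset.sum_le_sum fun g _ => Set.indicator_apply_le' (fun _ => le_rfl) (fun _ => zero_le)
      _ = S.card := by simp
      _ ≤ F.card := by
          rw [hS]
          exact_mod_cast Finset.card_image_le
  · simp only [not_exists] at hex
    have : ∀ g : (𝒮ℒ : Subgroup (GL (Fin 2) ℝ)), K.indicator (1 : ℍ → ℝ≥0∞) (g • w) = 0 :=
      fun g => Set.indicator_of_notMem (hex g) _
    rw [ENNReal.tsum_eq_zero.2 this]
    exact zero_le

/-- **Finite multiplicity on compact sets** (proper discontinuity of `SL₂(ℤ)` on `ℍ`, Mathlib's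
`properlyDiscontinuousSL2ZRange`): for compact `K ⊆ ℍ` there is `M ∈ ℕ` with
`#{γ ∈ 𝒮ℒ : γ w ∈ K} ≤ M` for every `w ∈ ℍ`. [cite: Iwaniec2002, §2.1 (discontinuous groups), PDF pp. 27–28] -/
theorem exists_multiplicity_bound {K : Set ℍ} (hK : IsCompact K) :
    ∃ M : ℕ, ∀ w : ℍ,
      ∑' γ : (𝒮ℒ : Subgroup (GL (Fin 2) ℝ)), K.indicator (1 : ℍ → ℝ≥0∞) (γ • w) ≤ M := by
  classical
  have hfin : Set.Finite {γ : (𝒮ℒ : Subgroup (GL (Fin 2) ℝ)) | ((γ • ·) '' K ∩ K).Nonempty} :=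
    ProperlyDiscontinuousSMul.finite_disjoint_inter_image hK hK
  refine ⟨hfin.toFinset.card, fun w => ?_⟩
  have := tsum_indicator_smul_le_card (K := K) (F := hfin.toFinset) (fun γ hγ => by simpa using hγ) w
  exact_mod_cast this

/-- Multiplicities only decrease on passing to a subgroup `Γ ≤ 𝒮ℒ`. [folklore] -/
theorem tsum_indicator_smul_le_of_le {Γ : Subgroup (GL (Fin 2) ℝ)}
    (hΓ : Γ ≤ (𝒮ℒ : Subgroup (GL (Fin 2) ℝ))) (K : Set ℍ) (w : ℍ) :
    ∑' γ : Γ, K.indicator (1 : ℍ → ℝ≥0∞) ((γ : GL (Fin 2) ℝ) • w) ≤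
      ∑' γ : (𝒮ℒ : Subgroup (GL (Fin 2) ℝ)), K.indicator (1 : ℍ → ℝ≥0∞) (γ • w) := by
  let ι : Γ → (𝒮ℒ : Subgroup (GL (Fin 2) ℝ)) := fun γ => ⟨γ, hΓ γ.2⟩
  have hι : Function.Injective ι := fun a b h =>
    Subtype.ext (congrArg (fun x : (𝒮ℒ : Subgroup (GL (Fin 2) ℝ)) => (x : GL (Fin 2) ℝ)) h)
  exact ENNReal.tsum_comp_le_tsum_of_injective hι
    (fun γ : (𝒮ℒ : Subgroup (GL (Fin 2) ℝ)) => K.indicator (1 : ℍ → ℝ≥0∞) (γ • w))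

/-- **Multiplicity bound by unfolding**: let `F` be a fundamental domain of a countable
`Γ ≤ SL₂(ℝ)` (in `GL₂(ℝ)`) with `-1 ∈ Γ`, `G ≥ 0` measurable and `Γ`-invariant, and `K` a
measurable set met by at most `M` points `γ w` (`γ ∈ Γ`) of every orbit.  Then
`∫_K G dμ ≤ (M/2) ∫_F G dμ`. [cite: Iwaniec2002, §3.2 (unfolding), PDF p. 42] -/
theorem setLIntegral_le_of_invariant {Γ : Subgroup (GL (Fin 2) ℝ)} {F : Set ℍ}
    (hΓ : Γ ≤ (Matrix.SpecialLinearGroup.toGL : SL(2, ℝ) →* GL (Fin 2) ℝ).range)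
    (hneg : (-1 : GL (Fin 2) ℝ) ∈ Γ) (hc : (Γ : Set (GL (Fin 2) ℝ)).Countable)
    (hF : IsHypFundamentalDomain Γ F) {G : ℍ → ℝ≥0∞} (hG : Measurable G)
    (hinv : ∀ γ ∈ Γ, ∀ z : ℍ, G (γ • z) = G z) {K : Set ℍ} (hK : MeasurableSet K) {M : ℝ≥0∞}
    (hM : ∀ w : ℍ, ∑' γ : Γ, K.indicator (1 : ℍ → ℝ≥0∞) ((γ : GL (Fin 2) ℝ) • w) ≤ M) :
    ∫⁻ z in K, G z ≤ M / 2 * ∫⁻ z in F, G z := by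
  haveI : Countable Γ := hc.to_subtype
  -- `2 ∫_K G = Σ_γ ∫_F 𝟙_K(γ w) G(γ w)`
  have hφ : Measurable fun z => K.indicator (1 : ℍ → ℝ≥0∞) z * G z :=
    (measurable_one.indicator hK).mul hG
  have hunf := tsum_setLIntegral_smul_eq hΓ hneg hc hF
    (φ := fun z => K.indicator (1 : ℍ → ℝ≥0∞) z * G z) hφ.aemeasurable
  have hKG : ∫⁻ z in K, G z = ∫⁻ z, K.indicator (1 : ℍ → ℝ≥0∞) z * G z := by
    rw [← lintegral_indicator hK]
    congr 1; funext z
    by_cases hz : z ∈ K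
    · simp [Set.indicator_of_mem hz]
    · simp [Set.indicator_of_notMem hz]
  -- invariance of `G` inside the sum, then swap sum and integral
  have hterm : ∀ γ : Γ, (fun w => K.indicator (1 : ℍ → ℝ≥0∞) ((γ : GL (Fin 2) ℝ) • w) *
      G ((γ : GL (Fin 2) ℝ) • w)) = fun w => K.indicator (1 : ℍ → ℝ≥0∞) ((γ : GL (Fin 2) ℝ) • w) * G w := by
    intro γ; funext w; rw [hinv _ γ.2]
  simp_rw [hterm] at hunf
  have hmeas : ∀ γ : Γ, AEMeasurable (fun w => K.indicator (1 : ℍ → ℝ≥0∞) ((γ : GL (Fin 2) ℝ) • w) * G w)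
      (volume.restrict F) := fun γ =>
    (((measurable_one.indicator hK).comp (measurable_const_smul (γ : GL (Fin 2) ℝ))).mul hG).aemeasurable
  rw [← lintegral_tsum hmeas] at hunf
  simp_rw [ENNReal.tsum_mul_right] at hunf
  -- bound the multiplicity by `M`
  have hle : ∫⁻ w in F, (∑' γ : Γ, K.indicator (1 : ℍ → ℝ≥0∞) ((γ : GL (Fin 2) ℝ) • w)) * G w ≤
      ∫⁻ w in F, M * G w := lintegral_mono fun w => mul_le_mul_of_nonneg_right (hM w) zero_le
  rw [hunf, lintegral_const_mul _ hG] at hle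
  rw [hKG]
  calc ∫⁻ z, K.indicator (1 : ℍ → ℝ≥0∞) z * G z
      = 2⁻¹ * (2 * ∫⁻ z, K.indicator (1 : ℍ → ℝ≥0∞) z * G z) := by
        rw [← mul_assoc, ENNReal.inv_mul_cancel (by norm_num) (by norm_num), one_mul]
    _ ≤ 2⁻¹ * (M * ∫⁻ z in F, G z) := by gcongr
    _ = M / 2 * ∫⁻ z in F, G z := by rw [div_eq_mul_inv]; ring

end DFI1995

end Literature.NumberTheory.Sieve
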